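import Summits.QuantumFields.YangMills.Theorems.UnitScaleTiltProp7StubEXOfChartPiecesTwS3SECtrDLift
import Summits.QuantumFields.YangMills.Theorems.UnitScaleTiltProp7StubEXOfChartPiecesTwS3SECtrDLiftG
import Summits.QuantumFields.YangMills.Theorems.UnitScaleTiltProp7StubEXOfChartPiecesTwS5
import Summits.QuantumFields.YangMills.Theorems.UnitScaleTiltProp7ChartWOfCov
import Summits.QuantumFields.YangMills.Theorems.UnitScaleTiltMinimiserStabilityRegPrPV3EChart
import HarnessLib

/-!
# «S5ECtrDLiftᵍ» — GUARD EDITION (L ≥ 5) of ✓`Prop7StubEXOfChartPiecesTwS5ECtrDLift.stubEX_of_chartPiecesTwS5ECtrD` (★★OWNER RULING №55∕№56, chair ★p1 g29 WORD №77 recipe; px13 g18 generator `guard_twin.py`).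
# Statement = the parent's VERBATIM except the ONE token-run `5 ≤ L →` inserted after `∀ (L : ℕ), 1 < L →` in (a) the conclusion, (b) the [B8] Thm 2 binder `hThm2S`, (c) the `hcoW` letter binder;
# every other letter, numeral and row VERBATIM.  Proof = the parent's with the callee replaced by ITS guard edition (+ the guarded∕totalised uses of Thm 2, see the theorem docstring).
# NOT the registered EX `stub_existenceMinimalOrbit` (all L > 1): «EX GUARDED (L ≥ 5) modulo the displayed letters»; crux 19200 AS REGISTERED stays OPEN (its L = 3 member ⟸ `hThm2S3` only);
# `--supports stmt-QuantumFields-19200 --as helper`; rung R3 = SU(2) YM₃ on T³ — NOT d = 4, NOT infinite volume, NOT a mass gap, NOT Clay.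

References: T. Bałaban, CMP **102** (1985) 277–309 [Balaban1985Variational] (Prop. 7 p.299, Prop. 6 p.295, (45)–(46) p.285, (112) p.294, (123)–(142) pp.296–299); CMP **98** (1985) 17–51
[Balaban1985Averaging] ((11)–(13) p.19, (89)–(92) p.31); [Balaban1985RegularSpaces] ((1.37) p.82, Thm 2 p.83); CMP **99** (1985) 389–434 [Balaban1985BackgroundPropagators] ((3.19)–(3.21) pp.393–394).
-/

set_option autoImplicit false

noncomputable section

open scoped BigOperators Matrix.Norms.L2Operator Matrix

namespace Summit.QuantumFields.YangMills.Theorems.Prop7StubEXOfChartPiecesTwS5ECtrDLiftG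

open NormedSpace
open Literature.MathematicalPhysics.QuantumFieldTheory.Balaban1983to89
open Literature.MathematicalPhysics.QuantumFieldTheory.Balaban1983to89.T3ContinuumYM3Torus
open Literature.MathematicalPhysics.QuantumFieldTheory.Balaban1983to89.T3UnitLawDensityEML (ℰp)
open Literature.MathematicalPhysics.QuantumFieldTheory.Balaban1983to89.T3TiltDescent (descendTo)
open Literature.MathematicalPhysics.QuantumFieldTheory.Balaban1983to89.T3ConstrainedMinimiser (fibre)
open Literature.MathematicalPhysics.QuantumFieldTheory.Balaban1983to89.T3PrintedRegularMinimiser (RegPr regFibrePr)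
open Literature.MathematicalPhysics.QuantumFieldTheory.Balaban1983to89.T3PrintedRegularOrbits (descTransf)
open Literature.MathematicalPhysics.QuantumFieldTheory.Balaban1983to89.T3PrintedMinimiserExistence (regPr_mono)
open Literature.MathematicalPhysics.QuantumFieldTheory.Balaban1983to89.T3Thm1Carrier
open Literature.MathematicalPhysics.QuantumFieldTheory.Balaban1983to89.T3SectALandauChart (In19 emb15 CloseAvg eta bgUnits pert)
open BlockAveragingEMLLinearisedBackground (pertVar)
open B9SectCLatticeCarrier (Bond)
open B10Eq27TorusAxialLog (unitsField toUField pull)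
open B11Eq115Space (NegSup NegSize Space115 JetSup)
open B11Eq111FrakG (nabla115)
open B11Eq98CurrentSlot (Jcur)
open B11Prop3Model (Dfix)
open B13Contraction113 (QuadAnalytic)
open B8Thm2SetupTorus (Thm2SetupSUAt)
open B8Thm2TorusAt (Cond135T C136T C139T)
open B8Thm4TorusAt (torusLam)
open B8Eq138LandauZd (IsLandau138)
open B7Prop1Explicit renaming Site → LSite
open B7Prop2SpecialUnitary (specialUnitaryUnits)
open MatrixLog (mlog)
open Summit.QuantumFields.YangMills.Theorems.Prop7TPrint (nMax19 expHermField)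
open Summit.QuantumFields.YangMills.Theorems.Prop7SPrint (AvgCondPrint AvgCondPrintS NormS IsLandauPrint IsLandauPrintS basePt RestrictedPrint IsAxialPrint)
open Summit.QuantumFields.YangMills.Theorems.Prop7SectET3Transport (periodsT3 siteEquiv siteEquiv_shiftEquiv bgOfCfg bondEquiv)
open Summit.QuantumFields.YangMills.Theorems.Prop7SymAvgTwSym (dbarTwS QTwS CmapTwS Chart47T3twS)
open Summit.QuantumFields.YangMills.Theorems.Prop7Bound20SymLog (bound20_symLog_of_closeAvg)
open Summit.QuantumFields.YangMills.Theorems.Prop7ChartPiecesTwG (hChart_of_piecesTwG hXtw_of_split_etaG hXtw'_of_splitG)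
open Summit.QuantumFields.YangMills.Theorems.Prop7StubEXOfChartPiecesTwS3SECtrDLift (stubEX_of_chartPiecesTwS3SECtrD)
open Summit.QuantumFields.YangMills.Theorems.Prop7StubEXOfChartPiecesTwS3SECtrDLiftG (stubEX_of_chartPiecesTwS3SECtrDLiftG)
open Summit.QuantumFields.YangMills.Theorems.Prop7ChartWOfCov (exists_hermChart_of_cov_at)
open Summit.QuantumFields.YangMills.Theorems.Prop7SPrintThm2Dict (thm2Based_of_thm2SetupSUAt)
open Summit.QuantumFields.YangMills.Theorems.PV3EChart (isMinOn_regFibrePr_of_thm2_coercive142_at)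
open Summit.QuantumFields.YangMills.Theorems.Prop7CovOfThm2 (cov_of_thm2SetupSUAt)
open B7Prop2Explicit (C0 c2' C0_pos c2'_pos)
open Literature.MathematicalPhysics.QuantumFieldTheory.Balaban1983to89.T3PrintedRegularOrbits (regPr_gaugeAct_iff)
open Literature.MathematicalPhysics.QuantumFieldTheory.Balaban1983to89.T3PrintedRegularMinimiser (mem_regFibrePr_iff)
open Summit.QuantumFields.YangMills.Theorems.Prop7StubEXOfChartPiecesTwSR (bsym_isHermitian_trace_zero)
open Summit.QuantumFields.YangMills.Theorems.Prop7SolutionRealityRowS (hA₁R_of_letterReality)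
open Summit.QuantumFields.YangMills.Theorems.Prop7DbarTwSymWindow (dbarTwS_window_of_regPr)
open Summit.QuantumFields.YangMills.Theorems.Prop7CmapTwSymInputs (chart47twS_of_regPr_eta)
open Summit.QuantumFields.YangMills.Theorems.Prop7StubEXOfChartPiecesTwL (windows_of_admissible three_le_memberL)
open Summit.QuantumFields.YangMills.Theorems.Prop7StubEXOfChartPiecesTwS (windows_of_W)
open Summit.QuantumFields.YangMills.Theorems.Prop7SymSliceWitness (exists_normS_of_regPr_of_size)
open Summit.QuantumFields.YangMills.Theorems.Prop7DbarTwWindow (norm_smul_I_le_of_nMax19_lt)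
open Summit.QuantumFields.YangMills.Theorems.Prop7B8Prop7Div (regPr_emb15_of_in19)
open Summit.QuantumFields.YangMills.Theorems.Prop7PV3CDELogChart (in19_expHermField_of_nMax19_lt)
open Summit.QuantumFields.YangMills.Theorems.Prop7ChartRealityRowS (hXtw''_of_reality)

variable {L : ℕ}

/-! ## §1 The knit v3.2ˢ -/

/-- (★p1 g29 WORD №77 (A) «TOTALISATION», generic form.) A family of pairs of positive constants known only under the guard `5 ≤ L` extends to ALL `L > 1`
(dummies `1, 1` below the guard), the payload kept under the guard — so every `L`-indexed window built from the constants stays total and exactly as typed. -/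
theorem exists₂_pos_total_of_guarded {P : ℕ → ℝ → ℝ → Prop}
    (h : ∀ (L : ℕ), 1 < L → 5 ≤ L → ∃ a b : ℝ, 0 < a ∧ 0 < b ∧ P L a b) :
    ∀ (L : ℕ), 1 < L → ∃ a b : ℝ, 0 < a ∧ 0 < b ∧ (5 ≤ L → P L a b) := by
  intro L hL
  by_cases h5 : 5 ≤ L
  · obtain ⟨a, b, ha, hb, hP⟩ := h L hL h5
    exact ⟨a, b, ha, hb, fun _ => hP⟩
  · exact ⟨1, 1, one_pos, one_pos, fun h => absurd h h5⟩

/-- («S5ECtrDLiftᵍ».) GUARD EDITION (L ≥ 5) of ✓`Prop7StubEXOfChartPiecesTwS5ECtrDLift.stubEX_of_chartPiecesTwS5ECtrD`: the parent's statement VERBATIM except `5 ≤ L →` inserted after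
`∀ (L : ℕ), 1 < L →` in the conclusion and in the binder `hThm2S`, (c) the `hcoW` letter binder; proof = the parent's over the guard edition of its callee.
NOT the registered EX (all L > 1) — «EX GUARDED (L ≥ 5) modulo the displayed letters»; CONDITIONAL on every displayed letter.
[cite: Balaban1985Variational, Prop. 7 p.299, (141)-(142) p.299, Prop. 2 p.281, (5) p.278, (51) p.286, (47)–(49) p.285, (103) p.293, (111)–(112) p.294, Props 5–6 pp.294–296, (19)–(21) p.281; Balaban1985RegularSpaces, Thm 2 p.83, (1.35)–(1.39) pp.82–83; Balaban1985BackgroundPropagators, Thm 3.12 p.420, (3.124) p.420] -/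
theorem stubEX_of_chartPiecesTwS5ECtrDLiftG
    [hFL : ∀ F : T3Family, Fact (0 < (F.L : ℝ))] [hFη : ∀ (F : T3Family) (k : ℕ), Fact (0 < ((F.L : ℝ)⁻¹) ^ k)]
    -- the LIFT antecedent of the S7′ chain, OPAQUE `L`- and member-indexed predicate (like `Lan`; ★px14 (T1)(T2) design, EX namer REVIEW PASS 21:59:22Z; text of record fixed only at the display)
    (Lift : ∀ (L : ℕ) (i : Idx L), GaugeField (i.1.1.P i.1.2.2) 0 (Matrix.specialUnitaryGroup (Fin 2) ℂ) → Prop)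
    -- the constants, member-uniform at each `L` (print: «absolute constants depending on d and L only»)
    (B₀ C₄ a₃ α r M : ℕ → ℝ) (hB₀ : ∀ L, 1 < L → 0 < B₀ L) (hC₄ : ∀ L, 1 < L → 0 < C₄ L) (ha₃ : ∀ L, 1 < L → 0 < a₃ L)
    (hα : ∀ L, 1 < L → 0 < α L) (hr : ∀ L, 1 < L → 0 < r L) (hM : ∀ L, 1 < L → 0 < M L)
    -- the `L²` weights of the projected Landau condition (21)ˢ `IsLandauPrintS` (display place (d); print: `c₀ = η³`, `cB = 1`)
    (c₀ cB : ℕ → ℝ) [hc₀ : ∀ L : ℕ, Fact (0 < c₀ L)]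
    -- the curved letters `𝔊(U₀)`, `(δ/δA′)V`, `H₁(U₀)`, OPAQUE (the datum `B` is FIXED to `Bsym` on `Λ_k = PBond (P n) 0`)
    (𝒢f : ∀ (L : ℕ) (i : Idx L) (U₀ : GaugeField (i.1.1.P i.1.2.2) 0 (Matrix.specialUnitaryGroup (Fin 2) ℂ)),
      NegSize (i.1.1.L : ℝ) (((i.1.1.L : ℝ)⁻¹) ^ (i.1.2.2 - i.1.2.1)) (fun _ : Bond 3 (periodsT3 i.1.1 i.1.2.2) => i.1.2.2 - i.1.2.1) 3
          (Matrix (Fin 2) (Fin 2) ℂ) →L[ℂ]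
        Space115 (i.1.1.L : ℝ) (((i.1.1.L : ℝ)⁻¹) ^ (i.1.2.2 - i.1.2.1)) (fun _ : Bond 3 (periodsT3 i.1.1 i.1.2.2) => i.1.2.2 - i.1.2.1)
          (fun _ : Bond 3 (periodsT3 i.1.1 i.1.2.2) × Fin 3 => i.1.2.2 - i.1.2.1) (nabla115 (((i.1.1.L : ℝ)⁻¹) ^ (i.1.2.2 - i.1.2.1)) (bgOfCfg i.1.1 i.1.2.2 U₀)))
    (Wf : ∀ (L : ℕ) (i : Idx L) (U₀ : GaugeField (i.1.1.P i.1.2.2) 0 (Matrix.specialUnitaryGroup (Fin 2) ℂ)),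
      Space115 (i.1.1.L : ℝ) (((i.1.1.L : ℝ)⁻¹) ^ (i.1.2.2 - i.1.2.1)) (fun _ : Bond 3 (periodsT3 i.1.1 i.1.2.2) => i.1.2.2 - i.1.2.1)
          (fun _ : Bond 3 (periodsT3 i.1.1 i.1.2.2) × Fin 3 => i.1.2.2 - i.1.2.1) (nabla115 (((i.1.1.L : ℝ)⁻¹) ^ (i.1.2.2 - i.1.2.1)) (bgOfCfg i.1.1 i.1.2.2 U₀)) →
        NegSize (i.1.1.L : ℝ) (((i.1.1.L : ℝ)⁻¹) ^ (i.1.2.2 - i.1.2.1)) (fun _ : Bond 3 (periodsT3 i.1.1 i.1.2.2) => i.1.2.2 - i.1.2.1) 3 (Matrix (Fin 2) (Fin 2) ℂ))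
    (H₁f : ∀ (L : ℕ) (i : Idx L) (U₀ : GaugeField (i.1.1.P i.1.2.2) 0 (Matrix.specialUnitaryGroup (Fin 2) ℂ)),
      (PBond (i.1.1.P i.1.2.1) 0 → Matrix (Fin 2) (Fin 2) ℂ) →L[ℂ]
        Space115 (i.1.1.L : ℝ) (((i.1.1.L : ℝ)⁻¹) ^ (i.1.2.2 - i.1.2.1)) (fun _ : Bond 3 (periodsT3 i.1.1 i.1.2.2) => i.1.2.2 - i.1.2.1)
          (fun _ : Bond 3 (periodsT3 i.1.1 i.1.2.2) × Fin 3 => i.1.2.2 - i.1.2.1) (nabla115 (((i.1.1.L : ℝ)⁻¹) ^ (i.1.2.2 - i.1.2.1)) (bgOfCfg i.1.1 i.1.2.2 U₀)))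
    -- their displayed bounds (the `SectEDatum` fields at admissible backgrounds)
    (norm_G : ∀ (L : ℕ), 1 < L → ∀ (i : Idx L) (ρ : ℝ) (U₀ : GaugeField (i.1.1.P i.1.2.2) 0 (Matrix.specialUnitaryGroup (Fin 2) ℂ)),
      RegPr i.1.1 i.1.2.1 i.1.2.2 ρ U₀ → ρ ≤ α L → Lift L i U₀ → ∀ f, ‖𝒢f L i U₀ f‖ ≤ B₀ L * ‖f‖)
    (prop4 : ∀ (L : ℕ), 1 < L → ∀ (i : Idx L) (ρ : ℝ) (U₀ : GaugeField (i.1.1.P i.1.2.2) 0 (Matrix.specialUnitaryGroup (Fin 2) ℂ)),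
      RegPr i.1.1 i.1.2.1 i.1.2.2 ρ U₀ → ρ ≤ α L → Lift L i U₀ → QuadAnalytic (Wf L i U₀) (C₄ L) (a₃ L))
    (norm_H₁ : ∀ (L : ℕ), 1 < L → ∀ (i : Idx L) (ρ : ℝ) (U₀ : GaugeField (i.1.1.P i.1.2.2) 0 (Matrix.specialUnitaryGroup (Fin 2) ℂ)),
      RegPr i.1.1 i.1.2.1 i.1.2.2 ρ U₀ → ρ ≤ α L → Lift L i U₀ → ∀ b, ‖H₁f L i U₀ b‖ ≤ B₀ L * ‖b‖)
    -- (45)–(46)-twˢ AT ITS η-ORDER, against the chart of record `Q := QTwS U₀`, (45) in the projected form `IsLandauPrintS` (d): print's letter `H` — `QH = I`, `RD*H = 0` (45), `‖HY‖ ≤ B_H·η·‖Y‖` (46), η = L^{−(K−n)} (DISPLAYED; supplier of record: [Balaban1985BackgroundPropagators]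
    -- Thm 3.12 for `H` (3.126), (3.133) n = 0,1 ⊕ (2.61); T³ statement p607026 `normH₁_row_of_recordObligations` with `Hsel := Hk`; O(η) = pure scaling `H_route = η·H_print`)
    -- CURE (α) of the fourth located lettering defect (2026-08-28): the (45)–(46) operator is a NAMED top-level letter `Hf` (beside `𝒢f Wf H₁f`; supplier instantiates `Hf L i U₀ := H46 … U₀`)
    (Hf : ∀ (L : ℕ) (i : Idx L) (U₀ : GaugeField (i.1.1.P i.1.2.2) 0 (Matrix.specialUnitaryGroup (Fin 2) ℂ)),
      (PBond (i.1.1.P i.1.2.1) 0 → Matrix (Fin 2) (Fin 2) ℂ) →ₗ[ℂ] (PBond (i.1.1.P i.1.2.2) 0 → Matrix (Fin 2) (Fin 2) ℂ))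
    (BH : ℕ → ℝ)
    (h45 : ∀ (L : ℕ), 1 < L → ∀ (i : Idx L) (U₀ : GaugeField (i.1.1.P i.1.2.2) 0 (Matrix.specialUnitaryGroup (Fin 2) ℂ)), RegPr i.1.1 i.1.2.1 i.1.2.2 (α L) U₀ → Lift L i U₀ →
      ∀ Y, QTwS i.1.1 i.1.2.1 i.1.2.2 i.2.2.le U₀ (Hf L i U₀ Y) = Y)
    (h45L : ∀ (L : ℕ), 1 < L → ∀ (i : Idx L) (U₀ : GaugeField (i.1.1.P i.1.2.2) 0 (Matrix.specialUnitaryGroup (Fin 2) ℂ)), RegPr i.1.1 i.1.2.1 i.1.2.2 (α L) U₀ → Lift L i U₀ →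
      ∀ Y, IsLandauPrintS i.1.1 i.1.2.1 i.1.2.2 i.2.2.le (c₀ L) (cB L) U₀ (Hf L i U₀ Y))
    (h46₀ : ∀ (L : ℕ), 1 < L → ∀ (i : Idx L) (U₀ : GaugeField (i.1.1.P i.1.2.2) 0 (Matrix.specialUnitaryGroup (Fin 2) ℂ)), RegPr i.1.1 i.1.2.1 i.1.2.2 (α L) U₀ → Lift L i U₀ →
      ∀ Y, ‖Hf L i U₀ Y‖ ≤ BH L * eta i.1.1 i.1.2.1 i.1.2.2 * ‖Y‖)
    (hHfR : ∀ (L : ℕ), 1 < L → ∀ (i : Idx L) (U₀ : GaugeField (i.1.1.P i.1.2.2) 0 (Matrix.specialUnitaryGroup (Fin 2) ℂ)), RegPr i.1.1 i.1.2.1 i.1.2.2 (α L) U₀ →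
      ∀ Y, (∀ c, star (Y c) = -Y c ∧ (Y c).trace = 0) → ∀ b', star (Hf L i U₀ Y b') = -Hf L i U₀ Y b' ∧ (Hf L i U₀ Y b').trace = 0)
    -- the radius `e L` of the witness ∕ window theorems and the two L-only numerals (WF) of W3 ∕ W5 ∕ the witness (replace (WΣ))
    (ef : ℕ → ℝ) (hef : ∀ L, 1 < L → 0 < ef L)
    (hWe : ∀ L : ℕ, 1 < L → 10 ^ 9 * (L : ℝ) ^ 2 * ef L ≤ 1) (hWε : ∀ L : ℕ, 1 < L → 10 ^ 12 * (L : ℝ) ^ 3 * α L ≤ 1)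
    -- the size window linking (CH5EL-twˢ)'s size row to the witness ∕ window radius, and the regularity window of the chart point
    (hMe : ∀ L, 1 < L → M L * α L < ef L)
    (hw137 : ∀ L : ℕ, 1 < L → 10 ^ 7 * (L : ℝ) ^ 3 * (178 * (α L + ef L)) ≤ 1)
    -- (CH47-twˢ) IS A THEOREM here (✓`Prop7CmapTwSymInputs.chart47twS_of_regPr_eta`): Prop. 3 for the chart of record at `C₂ := 40M₀ˢ∕(e·η)²`, `M₀ˢ = 6(2e + 2700Lε₀)`, radius `η·ε′`; its two η-free windows are displayed
    (ε' : ℕ → ℝ) (hBH0 : ∀ L : ℕ, 1 < L → 0 ≤ BH L)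
    (hq47 : ∀ L : ℕ, 1 < L → 9 * (40 * (2 * (3 * (2 * ef L + 2700 * (L : ℝ) * α L))) / ef L ^ 2) * BH L * ε' L < 1)
    (hR6 : ∀ L : ℕ, 1 < L → 6 * ε' L ≤ ef L)
    -- (102)-twS «Q𝔊 = 0» and (129)-twS «QH₁ = id» for print's `Q(U₀) = η·(QTwS U₀ ∘ ι)`, read through the (115)-space dictionary `ι` (DISPLAYED, N06-class rows about the opaque letters)
    (h102 : ∀ (L : ℕ), 1 < L → ∀ (i : Idx L) (U₀ : GaugeField (i.1.1.P i.1.2.2) 0 (Matrix.specialUnitaryGroup (Fin 2) ℂ)), RegPr i.1.1 i.1.2.1 i.1.2.2 (α L) U₀ → Lift L i U₀ →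
      ∀ f : NegSize (i.1.1.L : ℝ) (((i.1.1.L : ℝ)⁻¹) ^ (i.1.2.2 - i.1.2.1)) (fun _ : Bond 3 (periodsT3 i.1.1 i.1.2.2) => i.1.2.2 - i.1.2.1) 3 (Matrix (Fin 2) (Fin 2) ℂ),
        QTwS i.1.1 i.1.2.1 i.1.2.2 i.2.2.le U₀ (fun b : PBond (i.1.1.P i.1.2.2) 0 => JetSup.equiv _ _ _ (𝒢f L i U₀ f) (bondEquiv i.1.1 i.1.2.2 b)) = 0)
    (h129 : ∀ (L : ℕ), 1 < L → ∀ (i : Idx L) (U₀ : GaugeField (i.1.1.P i.1.2.2) 0 (Matrix.specialUnitaryGroup (Fin 2) ℂ)), RegPr i.1.1 i.1.2.1 i.1.2.2 (α L) U₀ → Lift L i U₀ →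
      ∀ B : PBond (i.1.1.P i.1.2.1) 0 → Matrix (Fin 2) (Fin 2) ℂ,
        QTwS i.1.1 i.1.2.1 i.1.2.2 i.2.2.le U₀ (fun b : PBond (i.1.1.P i.1.2.2) 0 => JetSup.equiv _ _ _ (H₁f L i U₀ B) (bondEquiv i.1.1 i.1.2.2 b)) =
          fun c => (((eta i.1.1 i.1.2.1 i.1.2.2 : ℝ) : ℂ))⁻¹ • B c)
    -- (102)-L «R_S D*𝔊 = 0» and (129)-L «R_S D*H₁ = 0» ((3.124)-S) in the projected form `IsLandauPrintS` (d), read through `ι` (DISPLAYED; definitional for the S suppliers)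
    (h102L : ∀ (L : ℕ), 1 < L → ∀ (i : Idx L) (U₀ : GaugeField (i.1.1.P i.1.2.2) 0 (Matrix.specialUnitaryGroup (Fin 2) ℂ)), RegPr i.1.1 i.1.2.1 i.1.2.2 (α L) U₀ → Lift L i U₀ →
      ∀ f : NegSize (i.1.1.L : ℝ) (((i.1.1.L : ℝ)⁻¹) ^ (i.1.2.2 - i.1.2.1)) (fun _ : Bond 3 (periodsT3 i.1.1 i.1.2.2) => i.1.2.2 - i.1.2.1) 3 (Matrix (Fin 2) (Fin 2) ℂ),
        IsLandauPrintS i.1.1 i.1.2.1 i.1.2.2 i.2.2.le (c₀ L) (cB L) U₀ (fun b : PBond (i.1.1.P i.1.2.2) 0 => JetSup.equiv _ _ _ (𝒢f L i U₀ f) (bondEquiv i.1.1 i.1.2.2 b)))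
    (h129L : ∀ (L : ℕ), 1 < L → ∀ (i : Idx L) (U₀ : GaugeField (i.1.1.P i.1.2.2) 0 (Matrix.specialUnitaryGroup (Fin 2) ℂ)), RegPr i.1.1 i.1.2.1 i.1.2.2 (α L) U₀ → Lift L i U₀ →
      ∀ B : PBond (i.1.1.P i.1.2.1) 0 → Matrix (Fin 2) (Fin 2) ℂ,
        IsLandauPrintS i.1.1 i.1.2.1 i.1.2.2 i.2.2.le (c₀ L) (cB L) U₀ (fun b : PBond (i.1.1.P i.1.2.2) 0 => JetSup.equiv _ _ _ (H₁f L i U₀ B) (bondEquiv i.1.1 i.1.2.2 b)))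
    -- the chart-radius window (exponent scale): print's `A′ = A₁ + H₁B` of (103) lies in the `ε₃`-ball of Prop. 3-tw, `η(r + 2B₀α) ≤ ε₃`
    (hrε : ∀ L : ℕ, 1 < L → r L + 2 * B₀ L * α L ≤ ε' L)
    -- (R-H₁) the letter `H₁(U₀)` is REAL: Hermitian-traceless data ↦ Hermitian-traceless-valued (115)-fields (DISPLAYED, N06-class clause on the `norm_H₁` letter)
    (hH₁R : ∀ (L : ℕ), 1 < L → ∀ (i : Idx L) (U₀ : GaugeField (i.1.1.P i.1.2.2) 0 (Matrix.specialUnitaryGroup (Fin 2) ℂ)), RegPr i.1.1 i.1.2.1 i.1.2.2 (α L) U₀ →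
      ∀ B : PBond (i.1.1.P i.1.2.1) 0 → Matrix (Fin 2) (Fin 2) ℂ, (∀ c, (B c).IsHermitian ∧ (B c).trace = 0) →
        ∀ b' : PBond (i.1.1.P i.1.2.2) 0, (JetSup.equiv _ _ _ (H₁f L i U₀ B) (bondEquiv i.1.1 i.1.2.2 b')).IsHermitian ∧
          (JetSup.equiv _ _ _ (H₁f L i U₀ B) (bondEquiv i.1.1 i.1.2.2 b')).trace = 0)
    -- (R-𝒢) the letter `𝔊(U₀)` is REAL: Hermitian-traceless (−3)-data ↦ Hermitian-traceless (115)-fields (DISPLAYED, N06-class clause on the `norm_G` letter)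
    (h𝒢R : ∀ (L : ℕ), 1 < L → ∀ (i : Idx L) (U₀ : GaugeField (i.1.1.P i.1.2.2) 0 (Matrix.specialUnitaryGroup (Fin 2) ℂ)), RegPr i.1.1 i.1.2.1 i.1.2.2 (α L) U₀ →
      ∀ f : NegSize (i.1.1.L : ℝ) (((i.1.1.L : ℝ)⁻¹) ^ (i.1.2.2 - i.1.2.1)) (fun _ : Bond 3 (periodsT3 i.1.1 i.1.2.2) => i.1.2.2 - i.1.2.1) 3 (Matrix (Fin 2) (Fin 2) ℂ),
        (∀ b, (NegSup.equiv _ _ f b).IsHermitian ∧ (NegSup.equiv _ _ f b).trace = 0) →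
        ∀ b, (JetSup.equiv _ _ _ (𝒢f L i U₀ f) b).IsHermitian ∧ (JetSup.equiv _ _ _ (𝒢f L i U₀ f) b).trace = 0)
    -- (R-W) the letter `(δ∕δA′)V` is REAL on its ball: Hermitian-traceless (115)-fields ↦ Hermitian-traceless (−3)-data (DISPLAYED, P4-class clause on the `prop4` letter)
    (hWR : ∀ (L : ℕ), 1 < L → ∀ (i : Idx L) (U₀ : GaugeField (i.1.1.P i.1.2.2) 0 (Matrix.specialUnitaryGroup (Fin 2) ℂ)), RegPr i.1.1 i.1.2.1 i.1.2.2 (α L) U₀ → Lift L i U₀ →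
      ∀ A : Space115 (i.1.1.L : ℝ) (((i.1.1.L : ℝ)⁻¹) ^ (i.1.2.2 - i.1.2.1)) (fun _ : Bond 3 (periodsT3 i.1.1 i.1.2.2) => i.1.2.2 - i.1.2.1)
          (fun _ : Bond 3 (periodsT3 i.1.1 i.1.2.2) × Fin 3 => i.1.2.2 - i.1.2.1) (nabla115 (((i.1.1.L : ℝ)⁻¹) ^ (i.1.2.2 - i.1.2.1)) (bgOfCfg i.1.1 i.1.2.2 U₀)),
        ‖A‖ < a₃ L → (∀ b, (JetSup.equiv _ _ _ A b).IsHermitian ∧ (JetSup.equiv _ _ _ A b).trace = 0) →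
        ∀ b, (NegSup.equiv _ _ (Wf L i U₀ A) b).IsHermitian ∧ (NegSup.equiv _ _ (Wf L i U₀ A) b).trace = 0)
    -- the three `L`-only windows putting `ε₄ := r` in Prop. 6's uniqueness regime (118)∕(121)
    (hrα : ∀ L : ℕ, 1 < L → 2 * B₀ L * α L ≤ r L) (hr4 : ∀ L : ℕ, 1 < L → 4 * r L ≤ a₃ L) (hr16 : ∀ L : ℕ, 1 < L → 16 * B₀ L * C₄ L * r L ≤ 1)
    -- (CH5EL-twˢ)‴: (112) ∘ (123)–(140) ((19)-size) ∘ E–L (at the `NormS`-representatives) at print's `A′ = A₁ + H₁B` in the exponent scale `iη·(ι A₁ + ι(H₁B))`, for the REAL `H` of (45)–(46)-twˢ, chart remainder `Dfix (CmapTwS U₀)` (DISPLAYED, XL; no (20), (21), datum, NO REALITY — Prop. 5's «X is 𝔤-valued» is now proved)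
    (hXtw''' : ∀ (L : ℕ), 1 < L → ∀ (i : Idx L) (ε₁ : ℝ) (V : GaugeField (i.1.1.P i.1.2.1) 0 (Matrix.specialUnitaryGroup (Fin 2) ℂ))
      (U₀ : GaugeField (i.1.1.P i.1.2.2) 0 (Matrix.specialUnitaryGroup (Fin 2) ℂ)), 0 < ε₁ → PlaqSmall ε₁ V →
      RegPr i.1.1 i.1.2.1 i.1.2.2 ((L : ℝ) ^ 3 * (3 * (L : ℝ)) * ε₁) U₀ → CloseAvg i.1.1 i.1.2.1 i.1.2.2 i.2.2.le ((L : ℝ) ^ 3 * ε₁) V U₀ → Lift L i U₀ → (L : ℝ) ^ 3 * (3 * (L : ℝ)) * ε₁ ≤ α L →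
      ∀ A₁ : Space115 (i.1.1.L : ℝ) (((i.1.1.L : ℝ)⁻¹) ^ (i.1.2.2 - i.1.2.1)) (fun _ : Bond 3 (periodsT3 i.1.1 i.1.2.2) => i.1.2.2 - i.1.2.1)
          (fun _ : Bond 3 (periodsT3 i.1.1 i.1.2.2) × Fin 3 => i.1.2.2 - i.1.2.1) (nabla115 (((i.1.1.L : ℝ)⁻¹) ^ (i.1.2.2 - i.1.2.1)) (bgOfCfg i.1.1 i.1.2.2 U₀)),
        ‖A₁‖ < r L →
        A₁ + 𝒢f L i U₀ (Jcur (bgOfCfg i.1.1 i.1.2.2 U₀)) + 𝒢f L i U₀ (Wf L i U₀ (A₁ + H₁f L i U₀ (fun c : PBond (i.1.1.P i.1.2.1) 0 =>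
          (-Complex.I) • mlog (((V c : Matrix.specialUnitaryGroup (Fin 2) ℂ) : Matrix (Fin 2) (Fin 2) ℂ)
            * star ((descendTo i.1.1 ℰp i.1.2.1 i.1.2.2 i.2.2.le U₀ c : Matrix.specialUnitaryGroup (Fin 2) ℂ) : Matrix (Fin 2) (Fin 2) ℂ))))) = 0 →
        ∃ X : PBond (i.1.1.P i.1.2.2) 0 → Matrix (Fin 2) (Fin 2) ℂ,
          (((eta i.1.1 i.1.2.1 i.1.2.2 : ℝ) : ℂ) * Complex.I) • ((fun b : PBond (i.1.1.P i.1.2.2) 0 => JetSup.equiv _ _ _ A₁ (bondEquiv i.1.1 i.1.2.2 b))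
              + (fun b : PBond (i.1.1.P i.1.2.2) 0 => JetSup.equiv _ _ _ (H₁f L i U₀ (fun c : PBond (i.1.1.P i.1.2.1) 0 =>
          (-Complex.I) • mlog (((V c : Matrix.specialUnitaryGroup (Fin 2) ℂ) : Matrix (Fin 2) (Fin 2) ℂ)
            * star ((descendTo i.1.1 ℰp i.1.2.1 i.1.2.2 i.2.2.le U₀ c : Matrix.specialUnitaryGroup (Fin 2) ℂ) : Matrix (Fin 2) (Fin 2) ℂ)))) (bondEquiv i.1.1 i.1.2.2 b)))
            - Hf L i U₀ (Dfix (CmapTwS i.1.1 i.1.2.1 i.1.2.2 i.2.2.le U₀) (Hf L i U₀) (40 * (2 * (3 * (2 * ef L + 2700 * (i.1.1.L : ℝ) * α L))) / (ef L * eta i.1.1 i.1.2.1 i.1.2.2) ^ 2)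
              ((((eta i.1.1 i.1.2.1 i.1.2.2 : ℝ) : ℂ) * Complex.I) • ((fun b : PBond (i.1.1.P i.1.2.2) 0 => JetSup.equiv _ _ _ A₁ (bondEquiv i.1.1 i.1.2.2 b))
              + (fun b : PBond (i.1.1.P i.1.2.2) 0 => JetSup.equiv _ _ _ (H₁f L i U₀ (fun c : PBond (i.1.1.P i.1.2.1) 0 =>
          (-Complex.I) • mlog (((V c : Matrix.specialUnitaryGroup (Fin 2) ℂ) : Matrix (Fin 2) (Fin 2) ℂ)
            * star ((descendTo i.1.1 ℰp i.1.2.1 i.1.2.2 i.2.2.le U₀ c : Matrix.specialUnitaryGroup (Fin 2) ℂ) : Matrix (Fin 2) (Fin 2) ℂ)))) (bondEquiv i.1.1 i.1.2.2 b)))))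
            = (fun b => Complex.I • X b) ∧
          nMax19 i.1.1 i.1.2.1 i.1.2.2 U₀ X ≤ M L * ((L : ℝ) ^ 3 * (3 * (L : ℝ)) * ε₁) ∧
          (∀ u : GaugeTransf (i.1.1.P i.1.2.2) 0 (Matrix.specialUnitaryGroup (Fin 2) ℂ), NormS i.1.1 i.1.2.1 i.1.2.2 i.2.2.le U₀ X (expHermField X) u →
            GaugeField.gaugeAct u (emb15 U₀ (expHermField X)) ∈ fibre i.1.1 ℰp i.1.2.1 i.1.2.2 i.2.2.le V →
            ∀ γ : ℝ → GaugeField (i.1.1.P i.1.2.2) 0 (Matrix.specialUnitaryGroup (Fin 2) ℂ), γ 0 = GaugeField.gaugeAct u (emb15 U₀ (expHermField X)) →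
              (∀ t, γ t ∈ fibre i.1.1 ℰp i.1.2.1 i.1.2.2 i.2.2.le V) →
              (∀ b, DifferentiableAt ℝ (fun t => ((γ t b : Matrix.specialUnitaryGroup (Fin 2) ℂ) : Matrix (Fin 2) (Fin 2) ℂ)) 0) →
                deriv (fun t => wilsonAction4 (γ t)) 0 = 0))
    -- (P) THE ONE GROWTH ROW — [Balaban1985Variational] (141)–(142) IN THE LANDAU CHART AT THE CRITICAL BACKGROUND, in E′'s `hco` LETTERS (✓`…PV3EChart.stub_PV3E_of_thm2_coercive142`)
    -- with R2-criticality replaced by the knit's E–L clause (stationarity along bondwise-differentiable fibre curves): every Theorem-2 chart point `U₁W`, `U₁ = e^{iηA}`,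
    -- (1.36)∕(1.38)∕(1.39) at radius `α ≤ c₇`, whose (1.29)-restricted `u`-image lies in (6)(e) ∩ 𝔅_k(V), has `A(W) ≤ A(U₁W)` (DISPLAYED; the α-P lane's row)
    (hcoW : ∀ (L : ℕ), 1 < L → 5 ≤ L → ∀ (B₁ : ℝ), 0 < B₁ → ∃ e₇ c₇ : ℝ, 0 < e₇ ∧ 0 < c₇ ∧
      ∀ (F : T3Family), F.L = L → ∀ (n K : ℕ) (hnK : n < K) (e α : ℝ) (V : GaugeField (F.P n) 0 (Matrix.specialUnitaryGroup (Fin 2) ℂ))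
        (W U₁ : GaugeField (F.P K) 0 (Matrix.specialUnitaryGroup (Fin 2) ℂ)) (u : GaugeTransf (F.P K) 0 (Matrix.specialUnitaryGroup (Fin 2) ℂ))
        (A : PBond (F.P K) 0 → Matrix (Fin 2) (Fin 2) ℂ),
        0 < e → e ≤ e₇ → 0 < α → α ≤ c₇ → W ∈ regFibrePr F n K hnK.le e V →
        (∀ γ : ℝ → GaugeField (F.P K) 0 (Matrix.specialUnitaryGroup (Fin 2) ℂ), γ 0 = W → (∀ t, γ t ∈ fibre F ℰp n K hnK.le V) →
          (∀ b, DifferentiableAt ℝ (fun t => ((γ t b : Matrix.specialUnitaryGroup (Fin 2) ℂ) : Matrix (Fin 2) (Fin 2) ℂ)) 0) →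
            deriv (fun t => wilsonAction4 (γ t)) 0 = 0) →
        RestrictedPrint F n K W u → (∀ b : PBond (F.P K) 0, IsSelfAdjoint (A b)) →
        (∀ b : PBond (F.P K) 0, ((U₁ b : Matrix.specialUnitaryGroup (Fin 2) ℂ) : Matrix (Fin 2) (Fin 2) ℂ) = exp (Complex.I • ((eta F n K) • A b))) →
        (∃ (β₀ B₂ : ℝ) (len : B7Prop1Explicit.Site (F.P K).d → ℝ),
          B8Thm2TorusAt.C136T (F.P K).L (K - n) (eta F n K) β₀ B₁ B₂ len α (pull (bgUnits F K W) (basePt F n K)) (pull A (basePt F n K))) →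
        B8Eq138LandauZd.IsLandau138 (F.P K).L (K - n) (eta F n K) (Set.univ : Set (B7Prop1Explicit.Site (F.P K).d)) (B8Thm4TorusAt.torusLam (K - n))
          (pull (bgUnits F K W) (basePt F n K)) (pull A (basePt F n K)) →
        B8Thm2TorusAt.C139T (F.P K).L (K - n) (eta F n K) B₁ α (pull (bgUnits F K W) (basePt F n K)) (pull A (basePt F n K)) →
        GaugeField.gaugeAct u (emb15 W U₁) ∈ regFibrePr F n K hnK.le e V →
          wilsonAction4 W ≤ wilsonAction4 (emb15 W U₁))
    -- ★★OWNER RULING g28-№8 (B) «DENSITY» (insurance line, pen px10 g3): THE IRREDUCIBLE-LIFT ROW `hIrrLift` (DISPLAYED, `Lift` opaque) IN THE PLACE OF SYM-CENTRE-R's `hSymCentre`: for `ε₁ ≤ aI L`,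
    -- over an IRREDUCIBLE datum `V` (every `V`-parallel `M₂(ℂ)`-valued site section is scalar) every printed-regular `U₀ ∈ 𝔅_k(V)` of radius `L³·3L·ε₁` carries the lift `Lift L i U₀` — a THEOREM
    -- at the `Lift` text of record (✓p675347 `Prop7StubEXOfDensityLift.irrLift_T3`); below, MIN-MACRO on the dense irreducible sector (✓p675282) passes to every datum by the limit lemma ✓p674041
    -- through the locally-onto descent ✓p676926 (spine ✓`Prop7StubEXByDensity.existenceMinimalOrbit_of_CminG_covCtr_irrLift`)
    (hIrrLift : ∀ (L : ℕ), 1 < L → ∃ aI : ℝ, 0 < aI ∧ ∀ (i : Idx L) (ε₁ : ℝ), 0 < ε₁ → ε₁ ≤ aI →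
        ∀ (V : GaugeField (i.1.1.P i.1.2.1) 0 (Matrix.specialUnitaryGroup (Fin 2) ℂ)) (U₀ : GaugeField (i.1.1.P i.1.2.2) 0 (Matrix.specialUnitaryGroup (Fin 2) ℂ)),
          (∀ cf : Site (i.1.1.P i.1.2.1) 0 → Matrix (Fin 2) (Fin 2) ℂ,
              (∀ b : PBond (i.1.1.P i.1.2.1) 0, cf b.src * ((V b : Matrix.specialUnitaryGroup (Fin 2) ℂ) : Matrix (Fin 2) (Fin 2) ℂ) =
                ((V b : Matrix.specialUnitaryGroup (Fin 2) ℂ) : Matrix (Fin 2) (Fin 2) ℂ) * cf b.tgt) →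
              ∃ z : ℂ, ∀ y : Site (i.1.1.P i.1.2.1) 0, cf y = z • (1 : Matrix (Fin 2) (Fin 2) ℂ)) →
          PlaqSmall ε₁ V → RegPr i.1.1 i.1.2.1 i.1.2.2 ((L : ℝ) ^ 3 * (3 * (L : ℝ)) * ε₁) U₀ → U₀ ∈ fibre i.1.1 ℰp i.1.2.1 i.1.2.2 i.2.2.le V → Lift L i U₀)
    -- (T2) the [B8] Thm 2 sockets AT THE SETUP-TORUS OBJECTS (`Thm2SetupSUAt`, rider dropped), one `(B₁, c₁)` per `L` (v3.2ˢ currency — the weakest both consumers need)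
    (hThm2S : ∀ (L : ℕ), 1 < L → 5 ≤ L → ∃ B₁ c₁ : ℝ, 0 < B₁ ∧ 0 < c₁ ∧ ∀ (F : T3Family), F.L = L → ∀ (n K : ℕ), n < K →
      ∃ (β₀ B₂ : ℝ) (len : B7Prop1Explicit.Site (F.P K).d → ℝ),
        Thm2SetupSUAt (F.P K) 2 (K - n) (eta F n K) β₀ B₁ B₂ c₁ len (fun _ => True)) :
    ∀ (L : ℕ), 1 < L → 5 ≤ L → ∀ (B₃ : ℝ), 4 < B₃ → ∃ a₁' O₁ : ℝ, 0 < a₁' ∧ 1 ≤ O₁ ∧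
    ∀ (F : T3Family), F.L = L → ∀ (n K : ℕ) (hnK : n < K) (ε₁ : ℝ), 0 < ε₁ →
      ∀ V : GaugeField (F.P n) 0 (Matrix.specialUnitaryGroup (Fin 2) ℂ), PlaqSmall ε₁ V →
        ∀ U₀ : GaugeField (F.P K) 0 (Matrix.specialUnitaryGroup (Fin 2) ℂ), RegPr F n K ((L : ℝ) ^ 3 * B₃ * ε₁) U₀ → U₀ ∈ fibre F ℰp n K hnK.le V →
          ε₁ ≤ a₁' → ∃ U ∈ regFibrePr F n K hnK.le (O₁ * (L : ℝ) ^ 3 * B₃ * ε₁) V,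
            IsMinOn (fun W : GaugeField (F.P K) 0 (Matrix.specialUnitaryGroup (Fin 2) ℂ) => wilsonAction4 W)
              (regFibrePr F n K hnK.le (O₁ * (L : ℝ) ^ 3 * B₃ * ε₁) V) U := by
  classical
  -- the constants of the two sockets: Theorem 2's `(B₁, c₁)` per `L`, COV at `B₃ := 1` from them (`B₁′, c₁′`), and the P-row's `(e₇, c₇)` at `B₁`
  -- (★p1 g29 WORD №77 (A) TOTALISATION) the guarded [B8] Thm 2 socket made TOTAL in `L` (dummies below the guard): every L-indexed window stays as typed
  have hT2 := exists₂_pos_total_of_guarded hThm2S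
  choose! B₁ c₁ hB₁ hc₁ hT using hT2
  have hC : ∀ L : ℕ, 1 < L → 5 ≤ L → ∃ B₁' c₁' : ℝ, 0 < B₁' ∧ 0 < c₁' ∧ _ := fun L hL h5 => cov_of_thm2SetupSUAt (B₃ := 1) zero_le_one (hB₁ L hL) (hc₁ L hL) (hT L hL h5)
  have hC' := exists₂_pos_total_of_guarded hC
  choose! B₁' c₁' hB₁' hc₁' hCOV using hC'
  choose! e₇ c₇ he₇ hc₇ hco using exists₂_pos_total_of_guarded fun L hL h5 => hcoW L hL h5 (B₁ L) (hB₁ L hL)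
  -- the window `aW` at the critical background: all thresholds of the E′ chart theorem and of COV@W, divided by 178 (`e := 178ε₄`)
  refine stubEX_of_chartPiecesTwS3SECtrDLiftG Lift B₀ C₄ a₃ α r M
    (fun L => min (min (min (min (min (min (1 / (6 * C0 3 * 1)) (c2' 3 L / (4 * 1))) ((10 ^ 8 * (L : ℝ) ^ 3)⁻¹))
      (c₁ L / (2 + 2 * (2 * (14336 + 21 / 20 * (((5 * (L : ℝ)) ^ 2 / 4) * (10800 * (L : ℝ) + 1)))))))
      (c₇ L / (2 + 2 * (2 * (14336 + 21 / 20 * (((5 * (L : ℝ)) ^ 2 / 4) * (10800 * (L : ℝ) + 1))))))) (e₇ L)) (c₁' L / 2) / 178)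
    hB₀ hC₄ ha₃ hα hr hM ?_ c₀ cB 𝒢f Wf H₁f norm_G prop4 norm_H₁ Hf BH h45 h45L h46₀ hHfR ef hef hWe hWε hMe hw137 ε' hBH0 hq47 hR6 h102 h129 h102L h129L hrε hH₁R h𝒢R hWR
    hrα hr4 hr16 hXtw'''
    -- the TAUTOLOGICAL slice at the critical background: Hermitian-traceless directions along which `W` does not lose action (LOCMIN_W is then its definition;
    -- all content sits in CHART_W, proved below from the E′ chart theorem — consuming `hcoW` — and COV at `W`)
    (fun L i W => {D | (∀ b : PBond (i.1.1.P i.1.2.2) 0, (D b).IsHermitian ∧ Matrix.trace (D b) = 0) ∧ wilsonAction4 W ≤ wilsonAction4 (emb15 W (expHermField D))})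
    ?_ (fun L _ i ε₁ ε₄ V U₀ X u W _ _ _ _ _ _ _ _ _ _ _ _ _ _ _ D hD _ => hD.2) hIrrLift hThm2S
  · -- `0 < aW L`
    intro L hL
    have hL0 : (0 : ℝ) < (L : ℝ) := by exact_mod_cast (show 0 < L by omega)
    have h1 := C0_pos 3
    have h2 := c2'_pos 3 L (by omega)
    have h3 := hc₁ L hL
    have h4 := hc₇ L hL
    have h5 := he₇ L hL
    have h6 := hc₁' L hL
    positivity
  · -- CHART_W at the critical background `W = (e^{iX}U₀)^u`, from the E′ chart theorem (IsMinOn over (6)(178ε₄) ∩ 𝔅_k(V)) and COV at `W`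
    intro L hL h5 i ε₁ ε₄ V U₀ X u W hε₁ hε₄4 hε₄W hlo hV hreg _hclose hXh hXε _h20 _h21 _hu hWdef hWfib hEL X' hX'ε hX'h h20' _h21'
    obtain ⟨⟨F, n, K⟩, hF, hnK⟩ := i
    simp only [Set.mem_setOf_eq] at hWdef hWfib hEL hreg hXε h20' hX'ε ⊢
    set CL : ℝ := 2 * (14336 + 21 / 20 * (((5 * (L : ℝ)) ^ 2 / 4) * (10800 * (L : ℝ) + 1))) with hCL_def
    have hL0 : (0 : ℝ) < (L : ℝ) := by exact_mod_cast (show 0 < L by omega)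
    have hFL : (F.L : ℝ) = (L : ℝ) := by exact_mod_cast hF
    have hCL0 : 0 ≤ CL := by positivity
    have hD : 0 < 2 + 2 * CL := by positivity
    -- the thresholds carried by `ε₄ ≤ aW L`, for `e := 178ε₄`
    set m : ℝ := min (min (min (min (min (min (1 / (6 * C0 3 * 1)) (c2' 3 L / (4 * 1))) ((10 ^ 8 * (L : ℝ) ^ 3)⁻¹)) (c₁ L / (2 + 2 * CL)))
      (c₇ L / (2 + 2 * CL))) (e₇ L)) (c₁' L / 2) with hm
    have hem : 178 * ε₄ ≤ m := by
      have : ε₄ ≤ m / 178 := hε₄W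
      linarith
    have heA : 178 * ε₄ ≤ min (1 / (6 * C0 3 * 1)) (c2' 3 L / (4 * 1)) :=
      hem.trans ((min_le_left _ _).trans ((min_le_left _ _).trans ((min_le_left _ _).trans ((min_le_left _ _).trans (min_le_left _ _)))))
    have he8 : 178 * ε₄ ≤ (10 ^ 8 * (F.L : ℝ) ^ 3)⁻¹ := by
      rw [hFL]; exact hem.trans ((min_le_left _ _).trans ((min_le_left _ _).trans ((min_le_left _ _).trans ((min_le_left _ _).trans (min_le_right _ _)))))
    have hec₁ : (2 + 2 * (2 * (14336 + 21 / 20 * (((5 * (F.L : ℝ)) ^ 2 / 4) * (10800 * (F.L : ℝ) + 1))))) * (178 * ε₄) ≤ c₁ L := by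
      rw [hFL, ← hCL_def]
      have h := hem.trans ((min_le_left _ _).trans ((min_le_left _ _).trans ((min_le_left _ _).trans (min_le_right _ _))))
      rwa [le_div_iff₀ hD, mul_comm] at h
    have hec₇ : (2 + 2 * (2 * (14336 + 21 / 20 * (((5 * (F.L : ℝ)) ^ 2 / 4) * (10800 * (F.L : ℝ) + 1))))) * (178 * ε₄) ≤ c₇ L := by
      rw [hFL, ← hCL_def]
      have h := hem.trans ((min_le_left _ _).trans ((min_le_left _ _).trans (min_le_right _ _)))
      rwa [le_div_iff₀ hD, mul_comm] at h
    have he₇' : 178 * ε₄ ≤ e₇ L := hem.trans ((min_le_left _ _).trans (min_le_right _ _))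
    have hec' : 178 * ε₄ + 178 * ε₄ ≤ c₁' L := by
      have h := hem.trans (min_le_right _ _)
      linarith
    -- the critical background and the competitor's axial copy lie in (6)(178ε₄) ∩ 𝔅_k(V) ([B8] Prop. 7 through (19))
    have h19 : In19 F n K ε₄ U₀ (expHermField X) X := in19_expHermField_of_nMax19_lt hXh hXε
    have h19' : In19 F n K ε₄ U₀ (expHermField X') X' := in19_expHermField_of_nMax19_lt hX'h hX'ε
    have hε₄0 : 0 < ε₄ := Prop7PV3CDELogChart.pos_of_in19 h19
    have he0 : (0 : ℝ) ≤ 178 * ε₄ := by positivity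
    have hRegW : RegPr F n K (178 * ε₄) W := by
      rw [hWdef]; exact (regPr_gaugeAct_iff F he0 u _).mpr (regPr_emb15_of_in19 (F := F) (n := n) (K := K) hε₄4 hlo hreg h19)
    have hWmem : W ∈ regFibrePr F n K hnK.le (178 * ε₄) V := (mem_regFibrePr_iff F).mpr ⟨hWfib, hRegW⟩
    obtain ⟨u', -, -, hW'fib⟩ := h20' (expHermField X') h19'.2.1
    have hRegW' : RegPr F n K (178 * ε₄) (GaugeField.gaugeAct u' (emb15 U₀ (expHermField X'))) :=
      (regPr_gaugeAct_iff F he0 u' _).mpr (regPr_emb15_of_in19 (F := F) (n := n) (K := K) hε₄4 hlo hreg h19')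
    have hW'mem : GaugeField.gaugeAct u' (emb15 U₀ (expHermField X')) ∈ regFibrePr F n K hnK.le (178 * ε₄) V :=
      (mem_regFibrePr_iff F).mpr ⟨hW'fib, hRegW'⟩
    -- `W` MINIMISES over (6)(178ε₄) ∩ 𝔅_k(V): the E′ chart theorem with Theorem 2 based at `W` (from the socket) and the P-row `hcoW` at `W`
    have hmin := isMinOn_regFibrePr_of_thm2_coercive142_at F hF hnK (c₇ := c₇ L) (Prop7StubEXOfChartPiecesTwS5.thm2Based_member_of_thm2SetupSUAt (hT L hL h5) F hF hnK) hWmem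
      (fun α' u₁ U₁ A hα0 hα7 hru hA hexp h136 h138 h139 hmem =>
        hco L hL h5 F hF n K hnK (178 * ε₄) α' V W U₁ u₁ A (by positivity) he₇' hα0 hα7 hWmem hEL hru hA hexp h136 h138 h139 hmem)
      heA he8 hec₁ hec₇
    have a2 : wilsonAction4 (GaugeField.gaugeAct u' (emb15 U₀ (expHermField X'))) = wilsonAction4 (emb15 U₀ (expHermField X')) :=
      T4WilsonGaugeFlatDirection.wilsonAction_gaugeAct 1 u' _
    have hle : wilsonAction4 W ≤ wilsonAction4 (emb15 U₀ (expHermField X')) := by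
      have h : wilsonAction4 W ≤ wilsonAction4 (GaugeField.gaugeAct u' (emb15 U₀ (expHermField X'))) := hmin hW'mem
      exact h.trans_eq a2
    -- the chart exponent `D` of the competitor at `W`, from COV at `W`
    obtain ⟨D, hDh, hAD⟩ := exists_hermChart_of_cov_at F hF hnK (hCOV L hL h5) hWmem hW'mem heA hec'
    have hA' : wilsonAction4 (emb15 U₀ (expHermField X')) = wilsonAction4 (emb15 W (expHermField D)) := a2.symm.trans hAD
    have hmemD : (∀ b : PBond (F.P K) 0, (D b).IsHermitian ∧ Matrix.trace (D b) = 0) ∧ wilsonAction4 W ≤ wilsonAction4 (emb15 W (expHermField D)) :=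
      ⟨hDh, hle.trans_eq hA'⟩
    exact ⟨D, hmemD, hDh, hA'⟩

end Summit.QuantumFields.YangMills.Theorems.Prop7StubEXOfChartPiecesTwS5ECtrDLiftG

end
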